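import Literature.AnabelianGeometry.EtaleTheta.TemperedFrobenioidProps
import Literature.AnabelianGeometry.EtaleTheta.Discharge.Sec3Thm37RatStd
import Literature.AnabelianGeometry.EtaleTheta.Discharge.Sec5Prop51Example39NonDilating

/-!
# [EtTh] §5 discharge: Proposition 5.1 at the Example 3.9 (iv) Frobenioid — the vocabulary pins
# "hypotheses of Corollary 3.8" and "rationally standard type" made REAL and derived

Mochizuki, *The étale theta function and its Frobenioid-theoretic manifestations*, Publ. RIMS **45** (2009),
Prop. 5.1 p. 323 (PDF p. 97) [cite: MochizukiEtTh2009, Prop 5.1 p.323 (PDF p.97)]: "The Frobenioid `C` is a tempered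
Frobenioid of rationally standard type over a slim base category `D`, whose monoid type is `ℤ`, and whose divisor
monoid `Φ(−)` is perfect, perf-factorial, non-dilating, and cuspidally pure. In particular, `C` and the
self-equivalence `Ψ : C ⥲ C` satisfy all of the hypotheses of Corollary 3.8, (i), (ii), (iii); Theorem 4.4";
Cor. 3.8 p. 80 (PDF p. 306): "for `i = 1, 2`, `C_i` is a tempered Frobenioid whose base category `D_i` is of
FSMFF-type, and whose divisor monoid `Φ_i` is non-dilating. Let `Ψ : C₁ ⥲ C₂` be an equivalence of categories";
Thm. 3.7 (ii) p. 79 (PDF p. 305): "Suppose `D` is of FSMFF-type, and that `Φ` is non-dilating. Then `C` is of standard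
type. If, moreover, `Φ` is rational …, then `C` is of rationally standard type"; Rmk. 3.7.2 p. 80: "`D₀` is slim … and
of FSM-, hence also of FSMFF-, type".  abc-iut cell, block C (W6 cone prover abc-iut-w6-d062), node EtTh:Prop5.1
(plan/L2 CONE-L2-STATUS: "3 pins OPEN (MERGE-PLAN row 3): IsRationallyStandard …; HypothesesCor38 …;
HypothesesThm44 …").  PROOF-ONLY sequel (no `def`) of `Discharge/Sec5Prop51Example39NonDilating.lean`, over
abc-iut-L2-t3's `TemperedFrobenioidProps.lean` (`Cor38Hyp` — the standing hypotheses of Cor. 3.8 AS TYPED),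
abc-iut-w4-d103's / abc-iut-w5-d250's `Discharge/Sec3Thm37Standard.lean` / `Sec3Thm37RatStd.lean` (Thm. 3.7 (ii) at
the canonical [FrdI] vocabulary) and abc-iut-L2-t9's `Discharge/Sec3Example39Base.lean`, `ThetaFrobenioidOfTempered.lean`
(`VocabParams`, `thetaVocab`, `applicability_of_model`).  Nothing landed is edited or restated; NO new vocabulary is
defined: the two pins are filled by STRUCTURE LITERALS of abc-iut-L2-t9's `VocabParams` inside the statements.

WHAT IS PROVED (for `C₀ := E.thetaFrobenioid α h`, the tempered Frobenioid of Example 3.9 (iv)).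
* `Example39Data.isOfFSMFFType_Dα` — `D_α` is of FSMFF-type as soon as `D_W` is of FSM-type (slices/bracket
  subcategories inherit FSM-type, abc-iut-L2-t9's `isOfFSMType_Dα`; FSM ⇒ FSMFF, [FrdI] §0, `IsOfFSMType.isOfFSMFFType`);
* `Example39Data.exists_cor38Hyp_thetaFrobenioid` — **pin "hypotheses of Corollary 3.8" REAL and DERIVED** (any monoid
  vocabulary `V`): for every self-equivalence `Ψ` of `C₀` there is a `Cor38Hyp C₀ C₀` with underlying equivalence
  `Ψ` — `D_α` of FSMFF-type (previous item) and `Φ_α^ell` non-dilating on both sides (`isNonDilating_Φα`), given only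
  `D_W` of FSM-type (Rmk. 3.7.2);
* `Example39Data.isOfStandardType_thetaFrobenioid` / `thm37_ii_ratStd_thetaFrobenioid` — **Thm. 3.7 (ii) for `C₀`**
  at the canonical vocabularies (`treeMonoidVocab`, `treeCatVocab`): `C₀` is of standard type given `hBmon` ([FrdI]
  Thm. 5.2 preamble "`B` a monoid on `D`") and `D_W` of FSM-type — "non-dilating" being DISCHARGED
  (`isNonDilatingOn_thetaFrobenioid`); and of RATIONALLY standard type at THE [FrdI] Def. 4.5 parameters given
  moreover "`Φ` rational" (`hrat`) and the invariance of the divisors of constants (`hKfix`, print p. 306 "`Π^tp_X`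
  acts trivially on `K^×/O_K^×`", cell GAP-LEDGER row G-w5d250-1) — abc-iut-w5-d250's `thm37_ii_ratStd_treeCatVocab'`
  BY NAME;
* `Example39Data.applicability_of_example39_pinned` — **Proposition 5.1 for §5 data over `C₀` with TWO of the three
  vocabulary pins REAL**: the `VocabParams` literal whose "rationally standard type" clause IS [FrdI] Def. 4.5 (iii)
  `IsOfRationallyStandardType` at `PreFrobenioid.rsParams` and whose "hypotheses of Cor. 3.8" clause IS
  `∃ hh : Cor38Hyp C₀ C₀, hh.Ψ = Ψ`; both are then THEOREMS, and `ApplicabilityOfGeneralTheory` holds modulo the named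
  inputs {`D_W` slim and of FSM-type (Rmk. 3.7.2), `Λ = ℤ`, `Example39_iv_cuspidallyPure` (F-0615), `hBmon`, `hrat`,
  `hKfix`} and the ONE remaining free pin "hypotheses of Theorem 4.4" (`H44 Ψ`; abc-iut-L2-t3's `Thm44Hyp` lives over
  a `BiKummerSetting` for `C₀`, plan/L2 W3-L2-01 — not constructed here).

HONEST FRAMING: reductions over abc-iut-L2-t3's DATA structure `Example39Data` and abc-iut-L2-t4's §5 DATA; nothing
asserts these data exist for an actual curve; [EtTh] is refereed and nothing here bears on [IUTchIII] Cor. 3.12 — no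
side is taken; typed ≠ proved — here PROVED modulo the named inputs.
-/

namespace Literature.AnabelianGeometry.EtaleTheta

open CategoryTheory Opposite Literature.AlgebraicGeometry.Frobenioids FrobenioidTheta TemperedFrobenioid

universe u v w

namespace Example39Data

/-! ### `D_α` of FSMFF-type; the standing hypotheses of Corollary 3.8 for `C₀` and any `Ψ` (any vocabulary) -/

section AnyVocab

variable {V : FrdIMonoidStub.{w}} {DW : Type u} [Category.{v} DW] {TW : RealifiedDivisorMonoids (D₀ := DW) V}
  (E : Example39Data V DW TW) {A B : DW} (α : A ⟶ B)

/-- `D_α` is of FSMFF-type as soon as `D_W` is of FSM-type (Rmk. 3.7.2: "`D₀` is … of FSM-, hence also of FSMFF-,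
type"; `D_α = (D_W)_B[α]` inherits FSM-type, abc-iut-L2-t9's `isOfFSMType_Dα`, and FSM ⇒ FSMFF, [FrdI] §0).
[cite: MochizukiEtTh2009, Rmk 3.7.2 p.80] -/
theorem isOfFSMFFType_Dα (hWf : IsOfFSMType DW) : IsOfFSMFFType (Dα α) :=
  (isOfFSMType_Dα α hWf).isOfFSMFFType

/-- **Pin "all of the hypotheses of Corollary 3.8" of Proposition 5.1, REAL and DERIVED for the Example 3.9 (iv)
Frobenioid** (abc-iut-L2-t3's `Cor38Hyp`: "`C_i` a tempered Frobenioid whose base category `D_i` is of FSMFF-type,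
and whose divisor monoid `Φ_i` is non-dilating; `Ψ : C₁ ⥲ C₂` an equivalence"): for `C₁ = C₂ = C₀ := E.thetaFrobenioid α h`
and ANY self-equivalence `Ψ`, such a hypothesis package with underlying equivalence `Ψ` EXISTS — `D_α` is of
FSMFF-type (`isOfFSMFFType_Dα`, from `D_W` of FSM-type) and `Φ_α^ell` is non-dilating (`isNonDilating_Φα`,
Example 3.9 (iii)/(iv)).  [cite: MochizukiEtTh2009, Prop 5.1 p.323 (PDF p.97)] -/
theorem exists_cor38Hyp_thetaFrobenioid {VD : FrdICatStub.{max u v, v, w} (Dα α)} (h : E.FrobenioidHyp α VD)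
    (hWf : IsOfFSMType DW) (Ψ : (E.thetaFrobenioid α h).category ≌ (E.thetaFrobenioid α h).category) :
    ∃ hh : Cor38Hyp (E.thetaFrobenioid α h) (E.thetaFrobenioid α h), hh.Ψ = Ψ :=
  ⟨⟨Ψ, ⟨isOfFSMFFType_Dα α hWf, isOfFSMFFType_Dα α hWf⟩,
      ⟨fun X f => E.isNonDilating_Φα α X f, fun X f => E.isNonDilating_Φα α X f⟩⟩, rfl⟩

end AnyVocab

/-! ### Theorem 3.7 (ii) for `C₀` and Proposition 5.1 with two pins real (canonical vocabularies) -/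

section TreeVocab

variable {DW : Type u} [Category.{v} DW] {TW : RealifiedDivisorMonoids (D₀ := DW) treeMonoidVocab.{w}}
  (E : Example39Data treeMonoidVocab.{w} DW TW) {A B : DW} (α : A ⟶ B)
  {IsRational IsStrictlyRational : ((Dα α)ᵒᵖ ⥤ CommMonCat.{w}) → Prop}

/-- **Theorem 3.7 (ii), first clause, for the Example 3.9 (iv) Frobenioid** (canonical vocabularies
`treeMonoidVocab` / `treeCatVocab`): `C₀ := E.thetaFrobenioid α h` is of standard type ([FrdI] Def. 3.1 (i), the
tree's `PreFrobenioidData.IsOfStandardType` of its model-Frobenioid data), given `hBmon` ([FrdI] Thm. 5.2 preamble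
"`B` a monoid on `D`") and `D_W` of FSM-type — "`Φ` non-dilating" is DISCHARGED (`isNonDilatingOn_thetaFrobenioid`) and
"`D` of FSMFF-type" is `isOfFSMFFType_Dα`; abc-iut-w4-d103's `isOfStandardType_treeCatVocab` BY NAME.
[cite: MochizukiEtTh2009, Thm 3.7 (ii) p.79] -/
theorem isOfStandardType_thetaFrobenioid
    (h : E.FrobenioidHyp α (treeCatVocab (Dα α) IsRational IsStrictlyRational))
    (hBmon : IsMonoidOn (E.thetaFrobenioid α h).ratFnFunctor) (hWf : IsOfFSMType DW) :
    (ModelFrobenioid.data (E.thetaFrobenioid α h).divisorMonoid (E.thetaFrobenioid α h).ratFnFunctor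
        (E.thetaFrobenioid α h).divBNatTrans).IsOfStandardType :=
  (E.thetaFrobenioid α h).isOfStandardType_treeCatVocab hBmon (isOfFSMFFType_Dα α hWf)
    (E.isNonDilatingOn_thetaFrobenioid α h)

/-- **Theorem 3.7 (ii), second clause, for the Example 3.9 (iv) Frobenioid** (canonical vocabularies; THE [FrdI]
Def. 4.5 parameters `PreFrobenioid.rsParams`): `C₀ := E.thetaFrobenioid α h` is of RATIONALLY standard type, given
`hBmon`, `D_W` of FSM-type, "`Φ` rational" at the support `PrimarySupp` (`hrat`, Def. 3.6 (ii)'s meaning of "`Φ`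
rational" — Example 3.9 (iv) p. 85: "the existence of the theta functions … implies that the monoid `Φ_α^ell` is also
rational") and the invariance of the divisors of constants under `Aut_{D_α}` (`hKfix`, print p. 306 "`Π^tp_X` acts
trivially on `K^×/O_K^×`"; cell GAP-LEDGER G-w5d250-1) — "non-dilating" and "FSMFF" DISCHARGED; abc-iut-w5-d250's
`thm37_ii_ratStd_treeCatVocab'` BY NAME.  [cite: MochizukiEtTh2009, Thm 3.7 (ii) p.79] -/
theorem thm37_ii_ratStd_thetaFrobenioid
    (h : E.FrobenioidHyp α (treeCatVocab (Dα α) IsRational IsStrictlyRational))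
    (hBmon : IsMonoidOn (E.thetaFrobenioid α h).ratFnFunctor) (hWf : IsOfFSMType DW)
    (hrat : ∀ X : (E.thetaFrobenioid α h).category,
      PreFrobenioidData.IsRational
        (PreFrobenioid.biratData ((E.thetaFrobenioid α h).isFrobenioid_treeCatVocab_of_isMonoidOn hBmon)
          (PreFrobenioid.hasBiratSquares_of_isFrobenioid
            ((E.thetaFrobenioid α h).isFrobenioid_treeCatVocab_of_isMonoidOn hBmon)))
        (S := PreFrobenioidData.ofFunctor (E.thetaFrobenioid α h).divisorMonoid (E.thetaFrobenioid α h).toElem)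
        (fun a 𝔭 => PrimarySupp a 𝔭) X)
    (hKfix : ∀ (X : Dα α) (f : X ≅ X) (b : TW.BΛ.obj ((E.thetaFrobenioid α h).baseOp (op X)))
      (ξ : Algebra.GrothendieckGroup ((E.thetaFrobenioid α h).Φ.carrier (op X))),
      b ∈ TW.FΛ ((E.thetaFrobenioid α h).baseOp (op X)) → (b, ξ) ∈ (E.thetaFrobenioid α h).ratFn (op X) →
        pullGp (E.thetaFrobenioid α h).divisorMonoid f.hom ξ = ξ) :
    (PreFrobenioidData.ofFunctor (E.thetaFrobenioid α h).divisorMonoid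
        (E.thetaFrobenioid α h).toElem).IsOfRationallyStandardType
      (PreFrobenioid.rsParams ((E.thetaFrobenioid α h).isFrobenioid_treeCatVocab_of_isMonoidOn hBmon)
        fun a 𝔭 => PrimarySupp a 𝔭) :=
  (E.thetaFrobenioid α h).thm37_ii_ratStd_treeCatVocab' hBmon (isOfFSMFFType_Dα α hWf)
    (E.isNonDilatingOn_thetaFrobenioid α h) hrat hKfix

/-- **Proposition 5.1 for §5 data over the Example 3.9 (iv) Frobenioid with TWO of the three vocabulary pins REAL and
DERIVED.**  Take abc-iut-L2-t9's `VocabParams` with: "rationally standard type" := [FrdI] Def. 4.5 (iii)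
`IsOfRationallyStandardType` of `C₀`'s data at THE parameters `PreFrobenioid.rsParams` (a THEOREM by
`thm37_ii_ratStd_thetaFrobenioid`); "all of the hypotheses of Corollary 3.8" for `Ψ` := "there is a `Cor38Hyp C₀ C₀`
with underlying equivalence `Ψ`" (a THEOREM by `exists_cor38Hyp_thetaFrobenioid`); "… of Theorem 4.4" := the
remaining free pin `H44` (abc-iut-L2-t3's `Thm44Hyp` needs a `BiKummerSetting` for `C₀`; plan/L2 W3-L2-01).  Then for
every §5 datum `𝔉` whose Frobenioid-level part is that of `C₀` and every self-equivalence `Ψ`,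
`ApplicabilityOfGeneralTheory 𝔉 (thetaVocab 𝔉 P) Ψ` holds, given the named inputs: `D_W` slim (`hW`) and of FSM-type
(`hWf`) (Rmk. 3.7.2), `Λ = ℤ` (`hZ`), `Φ_α^ell` cuspidally pure (`hcp`, F-0615), `hBmon`, `hrat`, `hKfix` (as in
`thm37_ii_ratStd_thetaFrobenioid`) and `H44 Ψ`.  "Tempered", "slim base", "perfect", "perf-factorial",
"non-dilating", "rationally standard", "hypotheses of Cor. 3.8" are all DERIVED.
[cite: MochizukiEtTh2009, Prop 5.1 p.323 (PDF p.97)] -/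
theorem applicability_of_example39_pinned
    (h : E.FrobenioidHyp α (treeCatVocab (Dα α) IsRational IsStrictlyRational))
    (hBmon : IsMonoidOn (E.thetaFrobenioid α h).ratFnFunctor)
    (hW : IsSlim DW) (hWf : IsOfFSMType DW) (hZ : TW.Λ = MonoidType.Z)
    (hcp : E.Example39_iv_cuspidallyPure α h)
    (hrat : ∀ X : (E.thetaFrobenioid α h).category,
      PreFrobenioidData.IsRational
        (PreFrobenioid.biratData ((E.thetaFrobenioid α h).isFrobenioid_treeCatVocab_of_isMonoidOn hBmon)
          (PreFrobenioid.hasBiratSquares_of_isFrobenioid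
            ((E.thetaFrobenioid α h).isFrobenioid_treeCatVocab_of_isMonoidOn hBmon)))
        (S := PreFrobenioidData.ofFunctor (E.thetaFrobenioid α h).divisorMonoid (E.thetaFrobenioid α h).toElem)
        (fun a 𝔭 => PrimarySupp a 𝔭) X)
    (hKfix : ∀ (X : Dα α) (f : X ≅ X) (b : TW.BΛ.obj ((E.thetaFrobenioid α h).baseOp (op X)))
      (ξ : Algebra.GrothendieckGroup ((E.thetaFrobenioid α h).Φ.carrier (op X))),
      b ∈ TW.FΛ ((E.thetaFrobenioid α h).baseOp (op X)) → (b, ξ) ∈ (E.thetaFrobenioid α h).ratFn (op X) →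
        pullGp (E.thetaFrobenioid α h).divisorMonoid f.hom ξ = ξ)
    (H44 : ((E.thetaFrobenioid α h).category ≌ (E.thetaFrobenioid α h).category) → Prop)
    (𝔉 : ThetaFrobenioid.{w} (E.thetaFrobenioid α h).category (Dα α))
    {hΦ : ∀ X : (Dα α)ᵒᵖ, IsIntegral ((E.thetaFrobenioid α h).Φ.carrier X)}
    {IsBFT : MorphismProperty (E.thetaFrobenioid α h).category}
    (h𝔉 : 𝔉.toTemperedFrobenioidStub = (E.thetaFrobenioid α h).thetaStub hΦ IsBFT)
    (Ψ : (E.thetaFrobenioid α h).category ≌ (E.thetaFrobenioid α h).category) (h44 : H44 Ψ) :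
    FrobenioidThetaBiKummer.ApplicabilityOfGeneralTheory 𝔉
      (thetaVocab 𝔉
        { IsRationallyStandard :=
            (PreFrobenioidData.ofFunctor (E.thetaFrobenioid α h).divisorMonoid
                (E.thetaFrobenioid α h).toElem).IsOfRationallyStandardType
              (PreFrobenioid.rsParams ((E.thetaFrobenioid α h).isFrobenioid_treeCatVocab_of_isMonoidOn hBmon)
                fun a 𝔭 => PrimarySupp a 𝔭)
          HypothesesCor38 := fun Ψ' => ∃ hh : Cor38Hyp (E.thetaFrobenioid α h) (E.thetaFrobenioid α h), hh.Ψ = Ψ'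
          HypothesesThm44 := H44 })
      Ψ :=
  E.applicability_of_example39_treeMonoidVocab α h 𝔉 _ h𝔉 Ψ
    (E.thm37_ii_ratStd_thetaFrobenioid α h hBmon hWf hrat hKfix) hW hZ hcp
    (E.exists_cor38Hyp_thetaFrobenioid α h hWf Ψ) h44

end TreeVocab

end Example39Data

end Literature.AnabelianGeometry.EtaleTheta
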